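import Summits.BirchSwinnertonDyer.BirchSwinnertonDyer.Theorems.TwoAdicConverseOrdLambdaHalfAtTwoGreenbergStableLine
import HarnessLib

/-!
# Route `TwoAdicConverse` (rung S3), crux `OrdLambdaHalfAtTwo` (item stmt-BirchSwinnertonDyer-19556), line
# `kato-determinant-greenberg-two`: the `GL(1)` residual input of B2 REDUCED to its three classical constituents

Cell `bsd-2adic`, seat `bsd-2adic-conv-1` GEN 25 (`--supports` stmt-BirchSwinnertonDyer-19556; helper; route-independent imports).
Fifth file of the B2 spine.  After p661101 (`…GreenbergStableLine`) B2 on habitat (β) has ONE displayed input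

  `hGL1(K,w,Σ)`: the residual Castella Selmer group `R_w^Σ(K_∞, M) = datumStrictSelmer (ker κ) M 2 (bdpData M 2 w) Σ` of an
  order-`2` module `M` is finite

(continuous quadratic characters of `Gal(K̄/K_∞)` unramified outside `Σ ∪ {v ∣ 2, v ≠ w}` and trivial on the decomposition groups
above `w`).  `NOTE-19556-GL1res-conv1-g25.md` (evidence #49 on the crux item) proves it on paper for every Greenberg field and
isolates its constituents; this file is the KERNEL form of that reduction, for ANY number field `K`, ANY normal `H ≤ Γ_K`, ANY
discrete module `M`, ANY prime `p` and ANY finite `Σ`: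

* **`finite_datumStrictSelmer_bdpData_of_inputs`** — `R_w^Σ(L, M)` (`L = K̄^H`) is finite provided
  [P1] the EVERYWHERE-UNRAMIFIED classes `{c ∈ H¹(H, M) | ∀ v σ, conj_σ c ∈ unramifiedKer H M v}` form a finite set
       (for `H = Gal(K̄/K_∞^{cyc})`, `M ≅ ℤ/p` trivial: «`X_nr(K_∞)/p` finite» ⟸ Iwasawa `μ = 0`, Ferrero–Washington for abelian `K`);
  [P23] for every `v ∈ Σ` prime to `p`, the classes modulo those unramified at every place above `v` form a finite group
       (`H¹(H, M) ⧸ ⨅_σ conj_σ⁻¹(unramifiedKer H M v)` finite: tame inertia has pro-`p` quotient `ℤ_p` and `v` is finitely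
       decomposed in `L` — local class field theory + «no finite place splits completely in the cyclotomic tower»);
  [C]  the `w̄`-STEP: a class unramified at every `v ∤ p` and STRICT at `w` (trivial on every decomposition group above `w`) is
       unramified at every place above `p` (for a Greenberg field: «a quadratic extension of `K_∞` unramified outside `w̄` and split
       above `w` is unramified everywhere» — global reciprocity for `K_n` and `ℚ_n` + Kronecker–Weber + Nakayama, NOTE §1 (a)).
  Proof: the classes of `R_w^Σ` modulo `N := R_w^Σ ∩ ⋂_{v ∈ Σ, v ∤ p} (unramified above v)` embed into the finite product of the
  [P23]-quotients; `N` consists of classes unramified at every `v ∤ p` and strict at `w`, hence ([C]) everywhere unramified, hence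
  ([P1]) finite; `#R = #(R/N) · #N`.
* **`greenbergStrictSelmerDual_finite_torsion_mu_on_beta_of_inputs`** — B2 on (β) (every Pontryagin-dual datum of the Greenberg
  strict-at-`w`/relaxed Selmer group of `E_K[2^∞]` over the cyclotomic `ℤ₂`-tower is `Λ`-f.g., `Λ`-torsion, `μ = 0`) from [P1],
  [P23], [C] for the order-`2` stable lines of `E_K[2]` (composes p661101).

HONEST FRAMING.  Bookkeeping over the tree's Selmer-condition subgroups; no definition, no named fact, no `sorry`; [P1], [P23], [C]
are displayed hypotheses (none is kernel-provable today: the tree has no class field theory); nothing about any particular curve is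
asserted; BSD is not proved by any of this.  PARTITION (D-0054): none — RANK axis S3 × X5@2 stratum (β); types-the-object-of.

References: B. Ferrero, L. Washington, Ann. of Math. 109 (1979) [FerreroWashington1979]; L. Washington, *Introduction to Cyclotomic
Fields* §13 [Washington1997]; J.-F. Jaulent, C. Maire, Canad. Math. Bull. 46 (2003) Thm 9, 12, 13, Ex. p. 189 [JaulentMaire2003];
J.-P. Serre, *Corps locaux* IV §2 [SerreCorpsLocaux]; R. Greenberg, V. Vatsal, Invent. Math. 142 (2000) §2 [GreenbergVatsal2000].
-/

set_option linter.dupNamespace false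
set_option autoImplicit false

noncomputable section

open scoped Classical

namespace Summit.BirchSwinnertonDyer.BirchSwinnertonDyer.Theorems.TwoAdicGreenbergCotorsion

open NumberField IsDedekindDomain Field WeierstrassCurve
open Literature.NumberTheory.EllipticCurves Literature.NumberTheory.EllipticCurves.GreenbergSelmer
  Literature.NumberTheory.EllipticCurves.GreenbergVatsal2000 Literature.NumberTheory.GaloisRepresentations
  Summit.BirchSwinnertonDyer.Rank1Residual.X11b Summit.BirchSwinnertonDyer.Rank1Residual.X11b.AcSelmer
  Summit.BirchSwinnertonDyer.Rank1Residual.X2.ResidualDevissageModules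

/-! ## §1 The abstract reduction -/

section Reduction

variable {K : Type} [Field K] [NumberField K] (H : Subgroup (absoluteGaloisGroup K)) [H.Normal]
  (M : Type) [AddCommGroup M] [DistribMulAction (absoluteGaloisGroup K) M] [TopologicalSpace M] [DiscreteTopology M]
  (p : ℕ) (w : HeightOneSpectrum (𝓞 K)) (hw : ((p : ℕ) : 𝓞 K) ∈ w.asIdeal) (S : Set (HeightOneSpectrum (𝓞 K)))

/-- An additive group `A` with a subgroup `N` such that both `N` and `A ⧸ N` are finite is finite (`#A = #(A ⧸ N) · #N`).
[folklore] -/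
theorem finite_of_finite_quotient_of_finite_addSubgroup {A : Type*} [AddCommGroup A] (N : AddSubgroup A)
    (hN : Finite N) (hQ : Finite (A ⧸ N)) : Finite A := by
  apply Nat.finite_of_card_ne_zero
  rw [N.card_eq_card_quotient_mul_card_addSubgroup]
  exact mul_ne_zero (Nat.card_pos (α := A ⧸ N)).ne' (Nat.card_pos (α := N)).ne'

/-- **`R_w^Σ(L, M)` is finite from [P1] ∧ [P23] ∧ [C]** (module docstring).  `L = K̄^H` for a normal `H ≤ Γ_K`; `M` any discrete
`Γ_K`-module; `p` any natural; `w` a place with `p ∈ w`; `Σ` FINITE.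
[P1] `hP1`: the everywhere-unramified classes of `H¹(H, M)` form a finite set;
[P23] `hP23`: for `v ∈ Σ` with `p ∉ v`, `H¹(H, M)` modulo the classes unramified at every place above `v` is finite;
[C] `hC`: a class unramified at every `v ∤ p` (`unramifiedOutside H M p ∅`) and strict at `w` (all conjugates) is unramified at every
`v` with `p ∈ v` (all conjugates).
[cite: JaulentMaire2003, Thm 12 and Example p. 189] [cite: Washington1997, §13.3] -/
theorem finite_datumStrictSelmer_bdpData_of_inputs (hSfin : S.Finite)
    (hP1 : {c : subgroupH1 H M | ∀ (v : HeightOneSpectrum (𝓞 K)) (σ : absoluteGaloisGroup K),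
      conjH1 H M σ c ∈ unramifiedKer H M v}.Finite)
    (hP23 : ∀ v ∈ S, ((p : ℕ) : 𝓞 K) ∉ v.asIdeal →
      Finite (subgroupH1 H M ⧸ ⨅ σ : absoluteGaloisGroup K, (unramifiedKer H M v).comap (conjH1 H M σ)))
    (hC : ∀ c : subgroupH1 H M, c ∈ unramifiedOutside H M p ∅ →
      (∀ σ : absoluteGaloisGroup K, conjH1 H M σ c ∈ (AcSelmer.bdpData M p w w hw).strictKer H) →
      ∀ (v : HeightOneSpectrum (𝓞 K)), ((p : ℕ) : 𝓞 K) ∈ v.asIdeal →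
        ∀ σ : absoluteGaloisGroup K, conjH1 H M σ c ∈ unramifiedKer H M v) :
    (datumStrictSelmer H M p (AcSelmer.bdpData M p w) S : Set (subgroupH1 H M)).Finite := by
  -- notation
  set R : AddSubgroup (subgroupH1 H M) := datumStrictSelmer H M p (AcSelmer.bdpData M p w) S
  -- the finite index type of tame places of `Σ`
  let T : Type := {v : HeightOneSpectrum (𝓞 K) // v ∈ S ∧ ((p : ℕ) : 𝓞 K) ∉ v.asIdeal}
  haveI : Finite T := (hSfin.subset fun v (hv : v ∈ S ∧ ((p : ℕ) : 𝓞 K) ∉ v.asIdeal) ↦ hv.1).to_subtype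
  -- the «unramified above v» subgroups and the product of quotient maps
  let U : T → AddSubgroup (subgroupH1 H M) := fun v ↦
    ⨅ σ : absoluteGaloisGroup K, (unramifiedKer H M v.1).comap (conjH1 H M σ)
  haveI hUfin : ∀ v : T, Finite (subgroupH1 H M ⧸ U v) := fun v ↦ hP23 v.1 v.2.1 v.2.2
  let φ : subgroupH1 H M →+ (Π v : T, subgroupH1 H M ⧸ U v) :=
    AddMonoidHom.pi fun v ↦ QuotientAddGroup.mk' (U v)
  haveI : Finite (Π v : T, subgroupH1 H M ⧸ U v) := Pi.finite
  -- restrict to `R`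
  let φR : R →+ (Π v : T, subgroupH1 H M ⧸ U v) := φ.comp R.subtype
  -- (1) the kernel consists of everywhere-unramified classes, hence is finite
  have hker : ∀ c : R, φR c = 0 → ∀ (v : HeightOneSpectrum (𝓞 K)) (σ : absoluteGaloisGroup K),
      conjH1 H M σ (c : subgroupH1 H M) ∈ unramifiedKer H M v := by
    intro c hc v σ
    have hcR : (c : subgroupH1 H M) ∈ datumStrictSelmer H M p (AcSelmer.bdpData M p w) S := c.2
    rw [mem_datumStrictSelmer_iff] at hcR
    obtain ⟨hunr, hstr⟩ := hcR
    -- unramified at the tame places of `Σ`: from the kernel condition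
    have hU : ∀ t : T, (c : subgroupH1 H M) ∈ U t := by
      intro t
      have h0 : QuotientAddGroup.mk' (U t) (c : subgroupH1 H M) = 0 := congrFun hc t
      rwa [QuotientAddGroup.mk'_apply, QuotientAddGroup.eq_zero_iff] at h0
    -- hence unramified at every `v ∤ p`
    have hout : (c : subgroupH1 H M) ∈ unramifiedOutside H M p ∅ := by
      rw [mem_unramifiedOutside_iff]
      intro v _ hpv τ
      by_cases hvS : v ∈ S
      · have h := hU ⟨v, hvS, hpv⟩
        simp only [U, AddSubgroup.mem_iInf, AddSubgroup.mem_comap] at h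
        exact h τ
      · exact (mem_unramifiedOutside_iff _).1 hunr v hvS hpv τ
    by_cases hpv : ((p : ℕ) : 𝓞 K) ∈ v.asIdeal
    · exact hC _ hout (fun τ ↦ hstr w hw τ) v hpv σ
    · exact (mem_unramifiedOutside_iff _).1 hout v (Set.notMem_empty v) hpv σ
  haveI hNfin : Finite φR.ker := by
    haveI : Finite {c : subgroupH1 H M | ∀ (v : HeightOneSpectrum (𝓞 K)) (σ : absoluteGaloisGroup K),
        conjH1 H M σ c ∈ unramifiedKer H M v} := hP1.to_subtype
    refine Finite.of_injective (fun c : φR.ker ↦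
      (⟨((c : R) : subgroupH1 H M), hker c.1 c.2⟩ : {c : subgroupH1 H M | ∀ (v : HeightOneSpectrum (𝓞 K))
        (σ : absoluteGaloisGroup K), conjH1 H M σ c ∈ unramifiedKer H M v})) ?_
    intro a b h
    have h' := congrArg Subtype.val h
    exact Subtype.ext (Subtype.ext h')
  -- (2) the quotient by the kernel embeds into the finite product
  haveI hQfin : Finite (R ⧸ φR.ker) :=
    Finite.of_injective (QuotientAddGroup.kerLift φR) (QuotientAddGroup.kerLift_injective φR)
  -- (3) conclude
  haveI : Finite R := finite_of_finite_quotient_of_finite_addSubgroup φR.ker hNfin hQfin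
  exact Set.toFinite _

end Reduction

/-! ## §2 B2 on (β) from the three inputs -/

section B2

variable (W : WeierstrassCurve ℚ) [W.IsElliptic] {K : Type} [Field K] [NumberField K]

/-- **B2 ON HABITAT (β) FROM [P1] ∧ [P23] ∧ [C].**  As `greenbergStrictSelmerDual_finite_torsion_mu_on_beta_of_GL1` (p661101), with its
single input `hGL1` replaced by the three constituents of `finite_datumStrictSelmer_bdpData_of_inputs`, each required for every
`Γ_K`-stable line `Φ ≤ E_K[2]` (a trivial `Γ_K`-module of order `2`), and `Σ` finite (the bad places of `E_K` prime to `2`).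
[cite: CastellaGrossiLeeSkinner2022, §1.4 Props. 17–18] [cite: JaulentMaire2003, Thm 12 and Example p. 189] -/
theorem greenbergStrictSelmerDual_finite_torsion_mu_on_beta_of_inputs (hred : ¬ W.HasIrreducibleModPGaloisRep 2)
    (κ : ZpExtension K 2) (hκ : κ.IsCyclotomic) {γ : absoluteGaloisGroup K} (hγ : κ.IsTopGenerator γ)
    {w : HeightOneSpectrum (𝓞 K)} (hw : ((2 : ℕ) : 𝓞 K) ∈ w.asIdeal)
    {S : Set (HeightOneSpectrum (𝓞 K))} (hSfin : S.Finite)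
    (hS : ∀ v : HeightOneSpectrum (𝓞 K), v ∉ S → ((2 : ℕ) : 𝓞 K) ∉ v.asIdeal → (W.baseChange K).HasGoodReductionAt v)
    (hP1 : ∀ Φ : StableSubgroup (absoluteGaloisGroup K) ((W.baseChange K).geomTorsion (2 : ℤ)), Nat.card Φ.Sub = 2 →
      {c : subgroupH1 κ.kerSubgroup Φ.Sub | ∀ (v : HeightOneSpectrum (𝓞 K)) (σ : absoluteGaloisGroup K),
        conjH1 κ.kerSubgroup Φ.Sub σ c ∈ unramifiedKer κ.kerSubgroup Φ.Sub v}.Finite)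
    (hP23 : ∀ Φ : StableSubgroup (absoluteGaloisGroup K) ((W.baseChange K).geomTorsion (2 : ℤ)), Nat.card Φ.Sub = 2 →
      ∀ v ∈ S, ((2 : ℕ) : 𝓞 K) ∉ v.asIdeal →
        Finite (subgroupH1 κ.kerSubgroup Φ.Sub ⧸
          ⨅ σ : absoluteGaloisGroup K, (unramifiedKer κ.kerSubgroup Φ.Sub v).comap (conjH1 κ.kerSubgroup Φ.Sub σ)))
    (hC : ∀ Φ : StableSubgroup (absoluteGaloisGroup K) ((W.baseChange K).geomTorsion (2 : ℤ)), Nat.card Φ.Sub = 2 →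
      ∀ c : subgroupH1 κ.kerSubgroup Φ.Sub, c ∈ unramifiedOutside κ.kerSubgroup Φ.Sub 2 ∅ →
        (∀ σ : absoluteGaloisGroup K, conjH1 κ.kerSubgroup Φ.Sub σ c ∈ (AcSelmer.bdpData Φ.Sub 2 w w hw).strictKer κ.kerSubgroup) →
        ∀ (v : HeightOneSpectrum (𝓞 K)), ((2 : ℕ) : 𝓞 K) ∈ v.asIdeal →
          ∀ σ : absoluteGaloisGroup K, conjH1 κ.kerSubgroup Φ.Sub σ c ∈ unramifiedKer κ.kerSubgroup Φ.Sub v)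
    (D : (W.baseChange K).GreenbergStrictSelmerDualData κ γ (AcSelmer.bdpData _ 2 w)) :
    Module.Finite (IwasawaAlgebra 2) D.X ∧ Module.IsTorsion (IwasawaAlgebra 2) D.X ∧ muInvariant 2 D.X = 0 :=
  greenbergStrictSelmerDual_finite_torsion_mu_on_beta_of_GL1 W hred κ hκ hγ hw hS
    (fun Φ hΦ2 ↦ finite_datumStrictSelmer_bdpData_of_inputs κ.kerSubgroup Φ.Sub 2 w hw S hSfin (hP1 Φ hΦ2) (hP23 Φ hΦ2)
      (hC Φ hΦ2)) D

end B2

end Summit.BirchSwinnertonDyer.BirchSwinnertonDyer.Theorems.TwoAdicGreenbergCotorsion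

end
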